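import Literature.NumberTheory.EllipticCurves.Kato2004.EulerSystemTatePairingValuesTwo
import Summits.BirchSwinnertonDyer.BirchSwinnertonDyer.Theorems.ThetaPartnerAtTwoSignedKatoUpToAtTwoFrameRigidity
import Summits.BirchSwinnertonDyer.BirchSwinnertonDyer.Theorems.ThetaPartnerAtTwoSignedTransportAtTwoStubSel2Tb
import HarnessLib

/-!
# K3 `SignedKatoDivisibilityUpToAtTwo`, line `colemanrat` — FRAME-A: the `2`-adic completion frame of the Kato pairing fact is
# immaterial (one continuous frame ⟹ every continuous frame), in the kernel

Cell `pub/bsd-wall`, width seat `bsd-wall-tp2-p2x-w3` g11, `--supports stmt-BirchSwinnertonDyer-20308` (helper; closes nothing).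
The named fact `F := Kato2004.exists_eulerSystem_expStar_tatePairing_values_two` (p640688; the displayed PUB stub behind CORE_KZ of
the registered line `colemanrat`; K3P′ ⟸ F alone) states its (KZ) pairing clause for EVERY continuous `2`-adic completion frame
`Φ : ℚ̄₂ ≅ \overline{ℚ_v}` over `φ : ℚ₂ ≅ ℚ_v`, while print fixes ONE embedding `ℚ̄ → ℚ̄_p`. The lead's audit
(`Cruxes/SignedKatoDivisibilityUpToAtTwo/G9-LEAD-AUDIT.md` §4, Step A) argues on paper that this is not stronger than print; this
file proves Step A IN THE KERNEL: `kz_rhs_gal_smul` (the (KZ) right-hand side under `ψ ∈ G_{ℚ₂}`: isometry ⟹ `ψ` passes the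
formal-log `tsum`), `kz_clause_transport` ((KZ) at `(Φ₀, ψ∘e, ψτψ⁻¹)` and `ψ_* Q₀` ⟹ (KZ) at `(Φ₀∘ψ, e, τ)` and `Q₀`, SAME `t`),
`expStarTatePairing_body_allFrames_of_oneFrame` (the body of `F` at ONE continuous frame ⟹ at EVERY continuous frame, SAME witnesses
`κ_K, Λ, z, x`: `φ = φ₀` by `Aut(ℚ₂) = 1` — `FrameChange.padicRingEquiv_eq` from the tree's `AbsTopIII.padicRingHom_self_eq_id` — so
`ψ := Φ₀⁻¹Φ ∈ G_{ℚ₂}`, and the one-frame hypothesis is instantiated at the conjugated tower), `exists_continuousFrame_two`, and the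
HEADLINE `expStarTatePairing_two_iff_oneFrame`: `F` ⟺ its ONE-FRAME form (`∃ Φ φ` in place of `∀ Φ φ`).
NOT done here (Steps B/C of the memo): changing the COHERENT TOWER `e` (absorbed by conjugating `z` by ONE global lift of
`u ∈ ℤ₂ˣ`) and the independence of the lift family `τ`. Theorems only (no `def`, no fact, no instance); standard axioms. HONEST
FRAMING: `F` stays a named, unproved, print fact; nothing here settles K3/K3P′; BSD is not proved by any of this.
-/

noncomputable section

open scoped Classical NumberField TensorProduct
open Field IsDedekindDomain CongruenceSubgroup NumberField WeierstrassCurve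
open Literature.NumberTheory.GaloisRepresentations
open Literature.NumberTheory.EllipticCurves Literature.NumberTheory.EllipticCurves.ModularForms
open Literature.NumberTheory.EllipticCurves.Rank1Residual Literature.NumberTheory.EllipticCurves.Kobayashi2003
open Literature.NumberTheory.EllipticCurves.Kato2004 Literature.NumberTheory.EllipticCurves.Kato2004.EulerSystemValues
open ZpExtension

set_option linter.dupNamespace false

namespace Summit.BirchSwinnertonDyer.BirchSwinnertonDyer.Theorems.SignedKatoOffTwo.FrameChange

/-! ## §1 The right-hand side of (KZ) under `ψ ∈ G_{ℚ₂}` -/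

/-- `ψ` passes through a `ℚ₂`-coefficient power series summed in `ℚ̄₂`: `ψ • Σᵢ aᵢ zⁱ = Σᵢ aᵢ (ψ • z)ⁱ` (summable or not).
[folklore] -/
theorem gal_smul_tsum_coeff_mul_pow {p : ℕ} [Fact p.Prime] (σ : Field.absoluteGaloisGroup ℚ_[p]) (a : ℕ → ℚ_[p])
    (z : PadicAlgCl p) :
    σ • (∑' i : ℕ, algebraMap ℚ_[p] (PadicAlgCl p) (a i) * z ^ i) =
      ∑' i : ℕ, algebraMap ℚ_[p] (PadicAlgCl p) (a i) * (σ • z) ^ i := by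
  rw [gal_smul_tsum]
  refine tsum_congr fun i => ?_
  rw [smul_mul', smul_pow', gal_smul_algebraMap]

/-- **The (KZ) right-hand side under a frame change.** For `ψ ∈ G_{ℚ₂}`, a lift family `τ`, an embedding value `w = e(x)` and a
parameter `z`: `ψ • Σ_b τ_b • (L(z) · w) = Σ_b (ψ τ_b ψ⁻¹) • (L(ψ • z) · ψ • w)`, `L(z) = Σᵢ aᵢ zⁱ`. [folklore] -/
theorem kz_rhs_gal_smul {p : ℕ} [Fact p.Prime] {m : ℕ} (ψ : Field.absoluteGaloisGroup ℚ_[p])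
    (τ : ZMod (p ^ m) → Field.absoluteGaloisGroup ℚ_[p]) (a : ℕ → ℚ_[p]) (z w : PadicAlgCl p) :
    ψ • (∑ b : (ZMod (p ^ m))ˣ, τ (b : ZMod (p ^ m)) • ((∑' i : ℕ, algebraMap ℚ_[p] (PadicAlgCl p) (a i) * z ^ i) * w)) =
      ∑ b : (ZMod (p ^ m))ˣ, (ψ * τ (b : ZMod (p ^ m)) * ψ⁻¹) •
        ((∑' i : ℕ, algebraMap ℚ_[p] (PadicAlgCl p) (a i) * (ψ • z) ^ i) * ψ • w) := by
  rw [Finset.smul_sum]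
  refine Finset.sum_congr rfl fun b _ => ?_
  rw [mul_smul, mul_smul, smul_mul' ψ⁻¹, ← gal_smul_tsum_coeff_mul_pow, inv_smul_smul, inv_smul_smul]

/-! ## §2 Points under `ψ ∈ G_{ℚ₂}` and the transport of the (KZ) clause -/

section Transport

variable {v : HeightOneSpectrum (𝓞 ℚ)} {W : WeierstrassCurve ℚ}

/-- `Φ₀ ∘ ψ = Φ` on points: `(Φ₀)_* (ψ_* Q) = Φ_* Q` (`g` = the action of `ψ` as a `ℚ`-algebra map). [folklore] -/
theorem map_map_gal_eq (Φ₀ Φ : AlgebraicClosure ℚ_[2] ≃ₐ[ℚ] AlgebraicClosure (v.adicCompletion ℚ))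
    (ψ : Field.absoluteGaloisGroup ℚ_[2]) (hψ : ∀ x : AlgebraicClosure ℚ_[2], Φ₀ (ψ • x) = Φ x)
    (g : AlgebraicClosure ℚ_[2] →ₐ[ℚ] AlgebraicClosure ℚ_[2]) (hg : ∀ x, g x = ψ • x)
    (Q : (W.baseChange (AlgebraicClosure ℚ_[2])).toAffine.Point) :
    WeierstrassCurve.Affine.Point.map (W' := W) (Φ₀ : AlgebraicClosure ℚ_[2] →ₐ[ℚ] AlgebraicClosure (v.adicCompletion ℚ))
        (WeierstrassCurve.Affine.Point.map (W' := W) g Q) =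
      WeierstrassCurve.Affine.Point.map (W' := W) (Φ : AlgebraicClosure ℚ_[2] →ₐ[ℚ] AlgebraicClosure (v.adicCompletion ℚ)) Q := by
  rw [WeierstrassCurve.Affine.Point.map_map]
  refine congrArg (fun g' : AlgebraicClosure ℚ_[2] →ₐ[ℚ] AlgebraicClosure (v.adicCompletion ℚ) =>
    WeierstrassCurve.Affine.Point.map (W' := W) g' Q) (AlgHom.ext fun x => ?_)
  rw [AlgHom.comp_apply, hg]
  exact hψ x

/-- The formal-group condition `|x(Q)|₂ > 1` is `G_{ℚ₂}`-invariant (Galois acts by isometries). [folklore] -/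
theorem formal_condition_map_gal (ψ : Field.absoluteGaloisGroup ℚ_[2])
    (g : AlgebraicClosure ℚ_[2] →ₐ[ℚ] AlgebraicClosure ℚ_[2]) (hg : ∀ x, g x = ψ • x)
    (Q : (W.baseChange (AlgebraicClosure ℚ_[2])).toAffine.Point)
    (hQ : ∀ (X Y : AlgebraicClosure ℚ_[2]) (hXY : (W.baseChange (AlgebraicClosure ℚ_[2])).toAffine.Nonsingular X Y),
      Q = .some X Y hXY → 1 < Valued.v X) :
    ∀ (X Y : AlgebraicClosure ℚ_[2]) (hXY : (W.baseChange (AlgebraicClosure ℚ_[2])).toAffine.Nonsingular X Y),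
      WeierstrassCurve.Affine.Point.map (W' := W) g Q = .some X Y hXY → 1 < Valued.v X := by
  intro X Y hXY h
  rcases Q with _ | ⟨X₀, Y₀, h₀⟩
  · cases h
  · rw [WeierstrassCurve.Affine.Point.map_some] at h
    obtain ⟨rfl, -⟩ := WeierstrassCurve.Affine.Point.some.inj h
    rw [hg, valuation_gal_smul]
    exact hQ X₀ Y₀ h₀ rfl

variable [W.IsElliptic] (κ : ZpExtension ℚ 2) [ContinuousSMul ℤ_[2] (W.tateModule 2)]

/-- **Transport of the (KZ) clause along a frame change.** Let `Φ = Φ₀ ∘ ψ` (`ψ ∈ G_{ℚ₂}`, acting through `g`). If the class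
`y` pairs with the `Φ₀`-image of `ψ_* Q₀` to `t ∈ ℤ₂` (residues `tatePairingPk`) and `t` satisfies the value identity at the frame
`(ψ ∘ e, ψ τ ψ⁻¹)` and the point `ψ_* Q₀`, then `y` pairs with the `Φ`-image of `Q₀` to the same `t`, and `t` satisfies the value
identity at `(e, τ)` and `Q₀`. [folklore] -/
theorem kz_clause_transport (Φ₀ Φ : AlgebraicClosure ℚ_[2] ≃ₐ[ℚ] AlgebraicClosure (v.adicCompletion ℚ))
    (ψ : Field.absoluteGaloisGroup ℚ_[2]) (hψ : ∀ x : AlgebraicClosure ℚ_[2], Φ₀ (ψ • x) = Φ x)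
    (g : AlgebraicClosure ℚ_[2] →ₐ[ℚ] AlgebraicClosure ℚ_[2]) (hg : ∀ x, g x = ψ • x)
    {n : ℕ} (e : CyclotomicField (cycLevel 2 (n + 2) ∅) ℚ →ₐ[ℚ] PadicAlgCl 2)
    (τ : ZMod (2 ^ (n + 2)) → Field.absoluteGaloisGroup ℚ_[2]) (y : H1 (tateRep W 2) (κ.layerSubgroup n))
    (xv : CyclotomicField (cycLevel 2 (n + 2) ∅) ℚ) (a : ℕ → ℚ_[2]) (Q₀ : localPoints W ℚ_[2])
    (hQv : WeierstrassCurve.Affine.Point.map (W' := W)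
        (Φ : AlgebraicClosure ℚ_[2] →ₐ[ℚ] AlgebraicClosure (v.adicCompletion ℚ))
        (show (W.baseChange (AlgebraicClosure ℚ_[2])).toAffine.Point from Q₀) ∈
      localLayerPointsOfEmb κ (closureEmb (K := ℚ) (v.adicCompletion ℚ)) W n)
    (hQv₀ : WeierstrassCurve.Affine.Point.map (W' := W)
        (Φ₀ : AlgebraicClosure ℚ_[2] →ₐ[ℚ] AlgebraicClosure (v.adicCompletion ℚ))
        (show (W.baseChange (AlgebraicClosure ℚ_[2])).toAffine.Point from
          (show localPoints W ℚ_[2] from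
            WeierstrassCurve.Affine.Point.map (W' := W) g (show (W.baseChange (AlgebraicClosure ℚ_[2])).toAffine.Point from Q₀))) ∈
      localLayerPointsOfEmb κ (closureEmb (K := ℚ) (v.adicCompletion ℚ)) W n)
    (t : ℤ_[2])
    (ht : ∀ k : ℕ, CyclotomicLayer.tatePairingPk W κ v n k y ⟨_, hQv₀⟩ = PadicInt.toZModPow k t)
    (htval : algebraMap ℚ_[2] (PadicAlgCl 2) (t : ℚ_[2]) =
      ∑ b : (ZMod (2 ^ (n + 2)))ˣ, (ψ * τ (b : ZMod (2 ^ (n + 2))) * ψ⁻¹) •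
        ((∑' i : ℕ, algebraMap ℚ_[2] (PadicAlgCl 2) (a i) *
            (WeierstrassCurve.Affine.Point.zCoord
              (show (W.baseChange (AlgebraicClosure ℚ_[2])).toAffine.Point from
                (show localPoints W ℚ_[2] from
                  WeierstrassCurve.Affine.Point.map (W' := W) g
                    (show (W.baseChange (AlgebraicClosure ℚ_[2])).toAffine.Point from Q₀)))) ^ i) *
          (g.comp e) xv)) :
    (∀ k : ℕ, CyclotomicLayer.tatePairingPk W κ v n k y ⟨_, hQv⟩ = PadicInt.toZModPow k t) ∧
      algebraMap ℚ_[2] (PadicAlgCl 2) (t : ℚ_[2]) =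
        ∑ b : (ZMod (2 ^ (n + 2)))ˣ, τ (b : ZMod (2 ^ (n + 2))) •
          ((∑' i : ℕ, algebraMap ℚ_[2] (PadicAlgCl 2) (a i) *
              (WeierstrassCurve.Affine.Point.zCoord (show (W.baseChange (AlgebraicClosure ℚ_[2])).toAffine.Point from Q₀)) ^ i) *
            e xv) := by
  have hpt := map_map_gal_eq (W := W) Φ₀ Φ ψ hψ g hg (show (W.baseChange (AlgebraicClosure ℚ_[2])).toAffine.Point from Q₀)
  refine ⟨fun k => ?_, ?_⟩
  · have hsub : (⟨_, hQv₀⟩ : localLayerPointsOfEmb κ (closureEmb (K := ℚ) (v.adicCompletion ℚ)) W n) = ⟨_, hQv⟩ :=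
      Subtype.ext hpt
    rw [← hsub]
    exact ht k
  · have hz : WeierstrassCurve.Affine.Point.zCoord
          (show (W.baseChange (AlgebraicClosure ℚ_[2])).toAffine.Point from
            (show localPoints W ℚ_[2] from
              WeierstrassCurve.Affine.Point.map (W' := W) g
                (show (W.baseChange (AlgebraicClosure ℚ_[2])).toAffine.Point from Q₀))) =
        ψ • WeierstrassCurve.Affine.Point.zCoord (show (W.baseChange (AlgebraicClosure ℚ_[2])).toAffine.Point from Q₀) := by
      rw [← hg]
      exact zCoord_map g _
    have he : (g.comp e) xv = ψ • e xv := by rw [AlgHom.comp_apply, hg]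
    rw [hz, he, ← kz_rhs_gal_smul] at htval
    -- now `htval : algebraMap t = ψ • Σ_b τ_b • (L(z(Q₀)) · e x)`; `algebraMap t` is `ψ`-fixed, cancel `ψ`
    have hfix : ψ • algebraMap ℚ_[2] (PadicAlgCl 2) (t : ℚ_[2]) = algebraMap ℚ_[2] (PadicAlgCl 2) (t : ℚ_[2]) :=
      gal_smul_algebraMap ψ _
    rw [← hfix] at htval
    exact MulAction.injective ψ htval

end Transport

/-! ## §3 One continuous frame ⟹ every continuous frame (Step A of `G9-LEAD-AUDIT.md` §4, in the kernel) -/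

section Body

variable (v : HeightOneSpectrum (𝓞 ℚ)) (W : WeierstrassCurve ℚ) [W.IsElliptic]
  (κ : ZpExtension ℚ 2) (hκ : κ.IsCyclotomic) (f : CuspForm (Gamma0 (W.conductorNorm ℤ)) 2)
  [ContinuousSMul ℤ_[2] (W.tateModule 2)] [Module.Free ℤ_[2] (W.tateModule 2)] [Module.Finite ℤ_[2] (W.tateModule 2)]

set_option backward.isDefEq.respectTransparency false in
/-- **FRAME-A (one frame ⟹ all frames).** The body of the fact `Kato2004.exists_eulerSystem_expStar_tatePairing_values_two` —
from `∃ κ_K` on: ONE `κ_K ≠ 0`, ONE `Λ`, for all admissible `(c, d, a, A)` classes `z` and values `x` with `ZetaBody` AND the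
(KZ) pairing clause — stated at ONE continuous `2`-adic completion frame `(Φ₀, φ₀)` for all coherent towers `(e, τ)` and all
pinned complex frames `ιC`, implies the same body at EVERY continuous frame `(Φ, φ)`, with the SAME witnesses. Proof: `φ = φ₀`
(`Aut(ℚ₂) = 1`), `ψ := Φ₀⁻¹Φ ∈ G_{ℚ₂}`; instantiate the hypothesis at the conjugated tower `(ψ ∘ e, ψ τ ψ⁻¹)` (again coherent
with lifts) and transport the (KZ) clause point by point along `Q₀ ↦ ψ_* Q₀` (`kz_clause_transport`: Galois acts by isometries,
passes the formal-log `tsum`, fixes `ℚ₂`, and `ZetaBody` does not see the `2`-adic frame). [folklore] -/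
theorem expStarTatePairing_body_allFrames_of_oneFrame
    (Φ₀ : AlgebraicClosure ℚ_[2] ≃ₐ[ℚ] AlgebraicClosure (v.adicCompletion ℚ)) (φ₀ : ℚ_[2] ≃+* v.adicCompletion ℚ)
    (hΦφ₀ : ∀ y : ℚ_[2], Φ₀ (algebraMap ℚ_[2] (AlgebraicClosure ℚ_[2]) y) =
      algebraMap (v.adicCompletion ℚ) (AlgebraicClosure (v.adicCompletion ℚ)) (φ₀ y))
    (H₀ : ∀ (e : ∀ k : ℕ, CyclotomicField (cycLevel 2 k ∅) ℚ →ₐ[ℚ] PadicAlgCl 2)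
        (τ : ∀ m : ℕ, ZMod (2 ^ m) → Field.absoluteGaloisGroup ℚ_[2]),
        (∀ k : ℕ, e (k + 1) (IsCyclotomicExtension.zeta (cycLevel 2 (k + 1) ∅) ℚ (CyclotomicField (cycLevel 2 (k + 1) ∅) ℚ)) ^ 2 =
          e k (IsCyclotomicExtension.zeta (cycLevel 2 k ∅) ℚ (CyclotomicField (cycLevel 2 k ∅) ℚ))) →
        (∀ (k : ℕ) (a : ZMod (2 ^ k)), IsUnit a →
          τ k a • e k (IsCyclotomicExtension.zeta (cycLevel 2 k ∅) ℚ (CyclotomicField (cycLevel 2 k ∅) ℚ)) =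
            e k (IsCyclotomicExtension.zeta (cycLevel 2 k ∅) ℚ (CyclotomicField (cycLevel 2 k ∅) ℚ)) ^ a.val) →
      ∀ (ιC : (m : ℕ) → (CyclotomicField m ℚ →+* ℂ)),
      (∀ k : ℕ, ιC (cycLevel 2 k ∅) (IsCyclotomicExtension.zeta (cycLevel 2 k ∅) ℚ (CyclotomicField (cycLevel 2 k ∅) ℚ)) =
        Complex.exp (2 * Real.pi * Complex.I / (cycLevel 2 k ∅ : ℕ))) →
      ∃ κK : ℝ, κK ≠ 0 ∧
      ∃ ΛK : ∀ (k : ℕ) (r : Finset (HeightOneSpectrum (𝓞 ℚ))),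
          H1 (tateRep W 2) (cycSubgroup 2 k r) →ₗ[ℤ_[2]] ℚ_[2] ⊗[ℚ] CyclotomicField (cycLevel 2 k r) ℚ,
        ∀ (c d a : ℤ) (A : ℕ), 0 < A → Int.gcd c (6 * 2 * A) = 1 → Int.gcd d (6 * 2 * W.conductorNorm ℤ) = 1 →
          ∃ (z : ∀ (k : ℕ) (r : (cyclotomicLevelsRat 2 (badPlaces c d A (W.conductorNorm ℤ))).Ideals),
                H1 (tateRep W 2) ((cyclotomicLevelsRat 2 (badPlaces c d A (W.conductorNorm ℤ))).level k r.1))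
            (x : ∀ (k : ℕ) (r : (cyclotomicLevelsRat 2 (badPlaces c d A (W.conductorNorm ℤ))).Ideals),
                CyclotomicField (cycLevel 2 k r.1) ℚ),
            ZetaBody W 2 f ιC κK ΛK c d a A z x ∧
            ∀ (n : ℕ) (Q₀ : localPoints W ℚ_[2])
              (hQv : WeierstrassCurve.Affine.Point.map (W' := W)
                  (Φ₀ : AlgebraicClosure ℚ_[2] →ₐ[ℚ] AlgebraicClosure (v.adicCompletion ℚ))
                  (show (W.baseChange (AlgebraicClosure ℚ_[2])).toAffine.Point from Q₀) ∈
                localLayerPointsOfEmb κ (closureEmb (K := ℚ) (v.adicCompletion ℚ)) W n),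
              (∀ (X Y : AlgebraicClosure ℚ_[2]) (hXY : (W.baseChange (AlgebraicClosure ℚ_[2])).toAffine.Nonsingular X Y),
                  (show (W.baseChange (AlgebraicClosure ℚ_[2])).toAffine.Point from Q₀) = .some X Y hXY → 1 < Valued.v X) →
              ∃ t : ℤ_[2],
                (∀ k : ℕ, CyclotomicLayer.tatePairingPk W κ v n k
                    (levelToLayerTwo W hκ (∅ : Set (HeightOneSpectrum (𝓞 ℚ))) n
                      (z (n + 2) (cyclotomicLevelsRat 2 (badPlaces c d A (W.conductorNorm ℤ))).idealOne))
                    ⟨_, hQv⟩ = PadicInt.toZModPow k t) ∧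
                algebraMap ℚ_[2] (PadicAlgCl 2) (t : ℚ_[2]) =
                  ∑ b : (ZMod (2 ^ (n + 2)))ˣ, τ (n + 2) (b : ZMod (2 ^ (n + 2))) •
                    ((∑' i : ℕ, algebraMap ℚ_[2] (PadicAlgCl 2) (PowerSeries.coeff i (W.map (algebraMap ℚ ℚ_[2])).formalLog) *
                        (WeierstrassCurve.Affine.Point.zCoord
                          (show (W.baseChange (AlgebraicClosure ℚ_[2])).toAffine.Point from Q₀)) ^ i) *
                      e (n + 2) (x (n + 2) (cyclotomicLevelsRat 2 (badPlaces c d A (W.conductorNorm ℤ))).idealOne)))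
    (Φ : AlgebraicClosure ℚ_[2] ≃ₐ[ℚ] AlgebraicClosure (v.adicCompletion ℚ)) (φ : ℚ_[2] ≃+* v.adicCompletion ℚ)
    (hΦφ : ∀ y : ℚ_[2], Φ (algebraMap ℚ_[2] (AlgebraicClosure ℚ_[2]) y) =
      algebraMap (v.adicCompletion ℚ) (AlgebraicClosure (v.adicCompletion ℚ)) (φ y))
    (e : ∀ k : ℕ, CyclotomicField (cycLevel 2 k ∅) ℚ →ₐ[ℚ] PadicAlgCl 2)
    (τ : ∀ m : ℕ, ZMod (2 ^ m) → Field.absoluteGaloisGroup ℚ_[2])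
    (hcoh : ∀ k : ℕ, e (k + 1) (IsCyclotomicExtension.zeta (cycLevel 2 (k + 1) ∅) ℚ (CyclotomicField (cycLevel 2 (k + 1) ∅) ℚ)) ^ 2 =
      e k (IsCyclotomicExtension.zeta (cycLevel 2 k ∅) ℚ (CyclotomicField (cycLevel 2 k ∅) ℚ)))
    (hτ : ∀ (k : ℕ) (a : ZMod (2 ^ k)), IsUnit a →
      τ k a • e k (IsCyclotomicExtension.zeta (cycLevel 2 k ∅) ℚ (CyclotomicField (cycLevel 2 k ∅) ℚ)) =
        e k (IsCyclotomicExtension.zeta (cycLevel 2 k ∅) ℚ (CyclotomicField (cycLevel 2 k ∅) ℚ)) ^ a.val)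
    (ιC : (m : ℕ) → (CyclotomicField m ℚ →+* ℂ))
    (hιC : ∀ k : ℕ, ιC (cycLevel 2 k ∅) (IsCyclotomicExtension.zeta (cycLevel 2 k ∅) ℚ (CyclotomicField (cycLevel 2 k ∅) ℚ)) =
      Complex.exp (2 * Real.pi * Complex.I / (cycLevel 2 k ∅ : ℕ))) :
    ∃ κK : ℝ, κK ≠ 0 ∧
      ∃ ΛK : ∀ (k : ℕ) (r : Finset (HeightOneSpectrum (𝓞 ℚ))),
          H1 (tateRep W 2) (cycSubgroup 2 k r) →ₗ[ℤ_[2]] ℚ_[2] ⊗[ℚ] CyclotomicField (cycLevel 2 k r) ℚ,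
        ∀ (c d a : ℤ) (A : ℕ), 0 < A → Int.gcd c (6 * 2 * A) = 1 → Int.gcd d (6 * 2 * W.conductorNorm ℤ) = 1 →
          ∃ (z : ∀ (k : ℕ) (r : (cyclotomicLevelsRat 2 (badPlaces c d A (W.conductorNorm ℤ))).Ideals),
                H1 (tateRep W 2) ((cyclotomicLevelsRat 2 (badPlaces c d A (W.conductorNorm ℤ))).level k r.1))
            (x : ∀ (k : ℕ) (r : (cyclotomicLevelsRat 2 (badPlaces c d A (W.conductorNorm ℤ))).Ideals),
                CyclotomicField (cycLevel 2 k r.1) ℚ),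
            ZetaBody W 2 f ιC κK ΛK c d a A z x ∧
            ∀ (n : ℕ) (Q₀ : localPoints W ℚ_[2])
              (hQv : WeierstrassCurve.Affine.Point.map (W' := W)
                  (Φ : AlgebraicClosure ℚ_[2] →ₐ[ℚ] AlgebraicClosure (v.adicCompletion ℚ))
                  (show (W.baseChange (AlgebraicClosure ℚ_[2])).toAffine.Point from Q₀) ∈
                localLayerPointsOfEmb κ (closureEmb (K := ℚ) (v.adicCompletion ℚ)) W n),
              (∀ (X Y : AlgebraicClosure ℚ_[2]) (hXY : (W.baseChange (AlgebraicClosure ℚ_[2])).toAffine.Nonsingular X Y),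
                  (show (W.baseChange (AlgebraicClosure ℚ_[2])).toAffine.Point from Q₀) = .some X Y hXY → 1 < Valued.v X) →
              ∃ t : ℤ_[2],
                (∀ k : ℕ, CyclotomicLayer.tatePairingPk W κ v n k
                    (levelToLayerTwo W hκ (∅ : Set (HeightOneSpectrum (𝓞 ℚ))) n
                      (z (n + 2) (cyclotomicLevelsRat 2 (badPlaces c d A (W.conductorNorm ℤ))).idealOne))
                    ⟨_, hQv⟩ = PadicInt.toZModPow k t) ∧
                algebraMap ℚ_[2] (PadicAlgCl 2) (t : ℚ_[2]) =
                  ∑ b : (ZMod (2 ^ (n + 2)))ˣ, τ (n + 2) (b : ZMod (2 ^ (n + 2))) •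
                    ((∑' i : ℕ, algebraMap ℚ_[2] (PadicAlgCl 2) (PowerSeries.coeff i (W.map (algebraMap ℚ ℚ_[2])).formalLog) *
                        (WeierstrassCurve.Affine.Point.zCoord
                          (show (W.baseChange (AlgebraicClosure ℚ_[2])).toAffine.Point from Q₀)) ^ i) *
                      e (n + 2) (x (n + 2) (cyclotomicLevelsRat 2 (badPlaces c d A (W.conductorNorm ℤ))).idealOne)) := by
  -- `φ = φ₀`, `ψ := Φ₀⁻¹ Φ ∈ G_{ℚ₂}`
  obtain ⟨ψ, hψ⟩ := exists_gal_frameChange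
    (algebraMap (v.adicCompletion ℚ) (AlgebraicClosure (v.adicCompletion ℚ))) Φ Φ₀ φ φ₀ hΦφ hΦφ₀
  -- `ψ` as a `ℚ`-algebra map
  let g : AlgebraicClosure ℚ_[2] →ₐ[ℚ] AlgebraicClosure ℚ_[2] :=
    ((AlgEquiv.restrictScalars ℚ (Field.absoluteGaloisGroup.toAlgEquiv ℚ_[2] ψ) :
        AlgebraicClosure ℚ_[2] ≃ₐ[ℚ] AlgebraicClosure ℚ_[2]) : AlgebraicClosure ℚ_[2] →ₐ[ℚ] AlgebraicClosure ℚ_[2])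
  have hg : ∀ x, g x = ψ • x := fun _ => rfl
  -- the conjugated tower `(ψ ∘ e, ψ τ ψ⁻¹)`: coherent, with lifts
  have hcoh₀ : ∀ k : ℕ, (g.comp (e (k + 1))) (IsCyclotomicExtension.zeta (cycLevel 2 (k + 1) ∅) ℚ
        (CyclotomicField (cycLevel 2 (k + 1) ∅) ℚ)) ^ 2 =
      (g.comp (e k)) (IsCyclotomicExtension.zeta (cycLevel 2 k ∅) ℚ (CyclotomicField (cycLevel 2 k ∅) ℚ)) := by
    intro k
    rw [AlgHom.comp_apply, AlgHom.comp_apply, ← map_pow, hcoh]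
  have hτ₀ : ∀ (k : ℕ) (a : ZMod (2 ^ k)), IsUnit a →
      (ψ * τ k a * ψ⁻¹) • (g.comp (e k)) (IsCyclotomicExtension.zeta (cycLevel 2 k ∅) ℚ (CyclotomicField (cycLevel 2 k ∅) ℚ)) =
        (g.comp (e k)) (IsCyclotomicExtension.zeta (cycLevel 2 k ∅) ℚ (CyclotomicField (cycLevel 2 k ∅) ℚ)) ^ a.val := by
    intro k a ha
    rw [AlgHom.comp_apply, hg, mul_smul, mul_smul, inv_smul_smul, hτ k a ha, smul_pow']
  obtain ⟨κK, hκK, ΛK, hmain⟩ := H₀ (fun k => g.comp (e k)) (fun m b => ψ * τ m b * ψ⁻¹) hcoh₀ hτ₀ ιC hιC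
  refine ⟨κK, hκK, ΛK, fun c d a A hA hc hd => ?_⟩
  obtain ⟨z, x, hbody, hKZ⟩ := hmain c d a A hA hc hd
  refine ⟨z, x, hbody, fun n Q₀ hQv hformal => ?_⟩
  have hpt := map_map_gal_eq (W := W) Φ₀ Φ ψ hψ g hg (show (W.baseChange (AlgebraicClosure ℚ_[2])).toAffine.Point from Q₀)
  have hQv₀ : WeierstrassCurve.Affine.Point.map (W' := W)
        (Φ₀ : AlgebraicClosure ℚ_[2] →ₐ[ℚ] AlgebraicClosure (v.adicCompletion ℚ))
        (show (W.baseChange (AlgebraicClosure ℚ_[2])).toAffine.Point from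
          (show localPoints W ℚ_[2] from
            WeierstrassCurve.Affine.Point.map (W' := W) g (show (W.baseChange (AlgebraicClosure ℚ_[2])).toAffine.Point from Q₀))) ∈
      localLayerPointsOfEmb κ (closureEmb (K := ℚ) (v.adicCompletion ℚ)) W n := by
    rw [show WeierstrassCurve.Affine.Point.map (W' := W)
        (Φ₀ : AlgebraicClosure ℚ_[2] →ₐ[ℚ] AlgebraicClosure (v.adicCompletion ℚ))
        (show (W.baseChange (AlgebraicClosure ℚ_[2])).toAffine.Point from
          (show localPoints W ℚ_[2] from
            WeierstrassCurve.Affine.Point.map (W' := W) g (show (W.baseChange (AlgebraicClosure ℚ_[2])).toAffine.Point from Q₀))) =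
        _ from hpt]
    exact hQv
  obtain ⟨t, ht, htval⟩ := hKZ n (show localPoints W ℚ_[2] from
      WeierstrassCurve.Affine.Point.map (W' := W) g (show (W.baseChange (AlgebraicClosure ℚ_[2])).toAffine.Point from Q₀))
    hQv₀ (formal_condition_map_gal ψ g hg _ hformal)
  exact ⟨t, kz_clause_transport κ Φ₀ Φ ψ hψ g hg (e (n + 2)) (τ (n + 2)) _ _ _ Q₀ hQv hQv₀ t ht htval⟩

end Body

/-! ## §4 A continuous frame exists; the ONE-FRAME form of the fact is equivalent to the fact -/

/-- **A continuous `2`-adic completion frame exists**: `Φ : ℚ̄₂ ≃ₐ[ℚ] \overline{ℚ_v}` over `φ : ℚ₂ ≃+* ℚ_v` for the place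
`v ∣ 2` (Mathlib `adicCompletion.padicEquiv` via the tree's `SignedTransportAtTwo.nonempty_algEquiv_padic_adicCompletion`, extended to
algebraic closures by `IsAlgClosure.equivOfEquiv`). [folklore] -/
theorem exists_continuousFrame_two (v : HeightOneSpectrum (𝓞 ℚ)) (hv : ((2 : ℕ) : 𝓞 ℚ) ∈ v.asIdeal) :
    ∃ (Φ : AlgebraicClosure ℚ_[2] ≃ₐ[ℚ] AlgebraicClosure (v.adicCompletion ℚ)) (φ : ℚ_[2] ≃+* v.adicCompletion ℚ),
      ∀ y : ℚ_[2], Φ (algebraMap ℚ_[2] (AlgebraicClosure ℚ_[2]) y) =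
        algebraMap (v.adicCompletion ℚ) (AlgebraicClosure (v.adicCompletion ℚ)) (φ y) := by
  obtain ⟨e⟩ := SignedTransportAtTwo.nonempty_algEquiv_padic_adicCompletion (p := 2) (v := v) hv
  let Φr : AlgebraicClosure ℚ_[2] ≃+* AlgebraicClosure (v.adicCompletion ℚ) :=
    IsAlgClosure.equivOfEquiv (AlgebraicClosure ℚ_[2]) (AlgebraicClosure (v.adicCompletion ℚ)) e.toRingEquiv
  have hf : ∀ y : ℚ_[2], Φr (algebraMap ℚ_[2] (AlgebraicClosure ℚ_[2]) y) =
      algebraMap (v.adicCompletion ℚ) (AlgebraicClosure (v.adicCompletion ℚ)) (e.toRingEquiv y) :=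
    fun y => IsAlgClosure.equivOfEquiv_algebraMap _ _ e.toRingEquiv y
  have hK : ∀ c : ℚ, Φr (algebraMap ℚ (AlgebraicClosure ℚ_[2]) c) = algebraMap ℚ (AlgebraicClosure (v.adicCompletion ℚ)) c := by
    intro c
    rw [eq_ratCast (algebraMap ℚ (AlgebraicClosure ℚ_[2])), eq_ratCast (algebraMap ℚ _), map_ratCast]
  exact ⟨{ Φr with commutes' := hK }, e.toRingEquiv, hf⟩

set_option backward.isDefEq.respectTransparency false in
/-- **HEADLINE — the `∀Φ ∀φ` quantification of the Kato pairing fact is harmless.** The named fact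
`Kato2004.exists_eulerSystem_expStar_tatePairing_values_two` (EVERY continuous `2`-adic completion frame) is EQUIVALENT to its
ONE-FRAME form (SOME continuous frame `(Φ, φ)`, everything else verbatim): `→` instantiates at a frame that exists
(`exists_continuousFrame_two`); `←` is `expStarTatePairing_body_allFrames_of_oneFrame` (rigidity `Aut(ℚ₂) = 1` and Galois transport
of the (KZ) clause). Print (Kato Thm. 12.5 (1), one fixed embedding `ℚ̄ → ℚ̄_p`) is the one-frame form; nothing is asserted about
the fact itself, which stays a named, unproved input. [folklore] -/
theorem expStarTatePairing_two_iff_oneFrame :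
    Kato2004.exists_eulerSystem_expStar_tatePairing_values_two ↔
    ∀ (v : HeightOneSpectrum (𝓞 ℚ)), ((2 : ℕ) : 𝓞 ℚ) ∈ v.asIdeal →
    ∀ (W : WeierstrassCurve ℚ) [W.IsElliptic] [W.IsGloballyMinimal], GoodSS W 2 →
      ∀ (κ : ZpExtension ℚ 2) (hκ : κ.IsCyclotomic),
        ∀ [NeZero (W.conductorNorm ℤ)] (f : CuspForm (Gamma0 (W.conductorNorm ℤ)) 2), IsNewformOf W f →
        ∀ [ContinuousSMul ℤ_[2] (W.tateModule 2)] [Module.Free ℤ_[2] (W.tateModule 2)]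
          [Module.Finite ℤ_[2] (W.tateModule 2)],
        ∃ (Φ : AlgebraicClosure ℚ_[2] ≃ₐ[ℚ] AlgebraicClosure (v.adicCompletion ℚ)) (φ : ℚ_[2] ≃+* v.adicCompletion ℚ),
          (∀ y : ℚ_[2], Φ (algebraMap ℚ_[2] (AlgebraicClosure ℚ_[2]) y) =
            algebraMap (v.adicCompletion ℚ) (AlgebraicClosure (v.adicCompletion ℚ)) (φ y)) ∧
        ∀ (e : ∀ k : ℕ, CyclotomicField (cycLevel 2 k ∅) ℚ →ₐ[ℚ] PadicAlgCl 2)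
          (τ : ∀ m : ℕ, ZMod (2 ^ m) → Field.absoluteGaloisGroup ℚ_[2]),
          (∀ k : ℕ, e (k + 1) (IsCyclotomicExtension.zeta (cycLevel 2 (k + 1) ∅) ℚ (CyclotomicField (cycLevel 2 (k + 1) ∅) ℚ)) ^ 2 =
            e k (IsCyclotomicExtension.zeta (cycLevel 2 k ∅) ℚ (CyclotomicField (cycLevel 2 k ∅) ℚ))) →
          (∀ (k : ℕ) (a : ZMod (2 ^ k)), IsUnit a →
            τ k a • e k (IsCyclotomicExtension.zeta (cycLevel 2 k ∅) ℚ (CyclotomicField (cycLevel 2 k ∅) ℚ)) =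
              e k (IsCyclotomicExtension.zeta (cycLevel 2 k ∅) ℚ (CyclotomicField (cycLevel 2 k ∅) ℚ)) ^ a.val) →
        ∀ (ιC : (m : ℕ) → (CyclotomicField m ℚ →+* ℂ)),
        (∀ k : ℕ, ιC (cycLevel 2 k ∅) (IsCyclotomicExtension.zeta (cycLevel 2 k ∅) ℚ (CyclotomicField (cycLevel 2 k ∅) ℚ)) =
          Complex.exp (2 * Real.pi * Complex.I / (cycLevel 2 k ∅ : ℕ))) →
        ∃ κK : ℝ, κK ≠ 0 ∧
        ∃ ΛK : ∀ (k : ℕ) (r : Finset (HeightOneSpectrum (𝓞 ℚ))),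
            H1 (tateRep W 2) (cycSubgroup 2 k r) →ₗ[ℤ_[2]] ℚ_[2] ⊗[ℚ] CyclotomicField (cycLevel 2 k r) ℚ,
          ∀ (c d a : ℤ) (A : ℕ), 0 < A → Int.gcd c (6 * 2 * A) = 1 → Int.gcd d (6 * 2 * W.conductorNorm ℤ) = 1 →
            ∃ (z : ∀ (k : ℕ) (r : (cyclotomicLevelsRat 2 (badPlaces c d A (W.conductorNorm ℤ))).Ideals),
                  H1 (tateRep W 2) ((cyclotomicLevelsRat 2 (badPlaces c d A (W.conductorNorm ℤ))).level k r.1))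
              (x : ∀ (k : ℕ) (r : (cyclotomicLevelsRat 2 (badPlaces c d A (W.conductorNorm ℤ))).Ideals),
                  CyclotomicField (cycLevel 2 k r.1) ℚ),
              ZetaBody W 2 f ιC κK ΛK c d a A z x ∧
              ∀ (n : ℕ) (Q₀ : localPoints W ℚ_[2])
                (hQv : WeierstrassCurve.Affine.Point.map (W' := W)
                    (Φ : AlgebraicClosure ℚ_[2] →ₐ[ℚ] AlgebraicClosure (v.adicCompletion ℚ))
                    (show (W.baseChange (AlgebraicClosure ℚ_[2])).toAffine.Point from Q₀) ∈
                  localLayerPointsOfEmb κ (closureEmb (K := ℚ) (v.adicCompletion ℚ)) W n),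
                (∀ (X Y : AlgebraicClosure ℚ_[2]) (hXY : (W.baseChange (AlgebraicClosure ℚ_[2])).toAffine.Nonsingular X Y),
                    (show (W.baseChange (AlgebraicClosure ℚ_[2])).toAffine.Point from Q₀) = .some X Y hXY → 1 < Valued.v X) →
                ∃ t : ℤ_[2],
                  (∀ k : ℕ, CyclotomicLayer.tatePairingPk W κ v n k
                      (levelToLayerTwo W hκ (∅ : Set (HeightOneSpectrum (𝓞 ℚ))) n
                        (z (n + 2) (cyclotomicLevelsRat 2 (badPlaces c d A (W.conductorNorm ℤ))).idealOne))
                      ⟨_, hQv⟩ = PadicInt.toZModPow k t) ∧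
                  algebraMap ℚ_[2] (PadicAlgCl 2) (t : ℚ_[2]) =
                    ∑ b : (ZMod (2 ^ (n + 2)))ˣ, τ (n + 2) (b : ZMod (2 ^ (n + 2))) •
                      ((∑' i : ℕ, algebraMap ℚ_[2] (PadicAlgCl 2) (PowerSeries.coeff i (W.map (algebraMap ℚ ℚ_[2])).formalLog) *
                          (WeierstrassCurve.Affine.Point.zCoord
                            (show (W.baseChange (AlgebraicClosure ℚ_[2])).toAffine.Point from Q₀)) ^ i) *
                        e (n + 2) (x (n + 2) (cyclotomicLevelsRat 2 (badPlaces c d A (W.conductorNorm ℤ))).idealOne)) := by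
  constructor
  · intro hF v hv W _ _ hss κ hκ _ f hf _ _ _
    obtain ⟨Φ, φ, hΦφ⟩ := exists_continuousFrame_two v hv
    exact ⟨Φ, φ, hΦφ, hF v hv W hss κ hκ f hf Φ φ hΦφ⟩
  · intro h1 v hv W _ _ hss κ hκ _ f hf _ _ _ Φ φ hΦφ e τ hcoh hτ ιC hιC
    obtain ⟨Φ₀, φ₀, hΦφ₀, H₀⟩ := h1 v hv W hss κ hκ f hf
    exact expStarTatePairing_body_allFrames_of_oneFrame v W κ hκ f Φ₀ φ₀ hΦφ₀ H₀ Φ φ hΦφ e τ hcoh hτ ιC hιC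

end Summit.BirchSwinnertonDyer.BirchSwinnertonDyer.Theorems.SignedKatoOffTwo.FrameChange
end
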